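import Mathlib
import Summits.Ventures.HodgeRepro2.T5UnramifiedOfGalois

/-!
# T5SplitsCompletely — «degree one ⇒ p splits completely», absolute and relative (ord)

Kernel form of the remaining sentences of step S0 of route/T5-CHECK-G-p7.md (v1.8 §12.2 rows
P1.3 and P1.5): for the datum, the chosen prime 𝔭 of the totally real cubic field F has
`[F_𝔭 : ℚ_p] = 1` and splits in the sextic Galois CM field E, so a prime 𝔓 of E above p has
`e = f = 1` over ℚ; since E/ℚ is Galois, EVERY prime of E above p has `e = f = 1`, i.e. p splits
completely in E, and hence every prime of F above p splits in E — Hsieh's hypothesis (ord)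
(arXiv:1112.1574 v3, Main_Body.tex l. 51) — and every CM type of E is p-ordinary (P1.5, prose).

* `inertiaDeg_eq_of_isGalois`: in a number field `K` Galois over `ℚ`, two primes above the same
  rational prime have the same inertia degree (companion of
  `T5UnramifiedOfGalois.ramificationIdx_eq_of_isGalois`).
* `degree_one_of_isGalois`: one prime above `p` with `e · f = 1` ⇒ every prime above `p` has
  `e · f = 1`.
* `ncard_primesOver_eq_finrank_of_degree_one`: … ⇒ the number of primes of the ring of integers
  above `p` is `[K : ℚ]` (Mathlib's Galois fundamental identity).
* `ncard_primesOver_eq_finrank_of_degree_one_tower`: tower `ℚ ⊂ F ⊂ E`, `E/ℚ` Galois, `𝔓` a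
  prime of `𝓞 E` above `𝔭 ⊂ 𝓞 F` with `e(𝔓|ℤ) · f(𝔓|ℤ) = 1` ⇒ `𝔭` has exactly `[E : F]`
  primes of `𝓞 E` above it.
* `ord_of_isGalois_of_degree_one`: (ord) — one degree-one prime of `𝓞 E` above `p` ⇒ every
  prime `𝔭` of `𝓞 F` above `p` has exactly `[E : F]` primes of `𝓞 E` above it.

Nothing about CM types, Hecke characters or L-functions is asserted. Mathlib + own
`T5UnramifiedOfGalois`; standard axioms.
-/

open scoped NumberField nonZeroDivisors

namespace Summit.Ventures.HodgeRepro2.T5SplitsCompletely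

section absolute

variable {K 𝒪 : Type*} [Field K] [NumberField K] [CommRing 𝒪] [Algebra 𝒪 K]
variable [IsIntegralClosure 𝒪 ℤ K]

/-- In a number field `K` Galois over `ℚ`, two primes `P`, `Q` of the ring of integers `𝒪`
lying over the same rational prime `p` have the same inertia degree over `ℤ`. -/
theorem inertiaDeg_eq_of_isGalois [IsGalois ℚ K] {p : ℤ} (hp : Prime p)
    (P Q : Ideal 𝒪) [P.IsPrime] [Q.IsPrime] (hP : (p : 𝒪) ∈ P) (hQ : (p : 𝒪) ∈ Q) :
    P.inertiaDeg ℤ = Q.inertiaDeg ℤ := by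
  have := (IsIntegralClosure.algebraMap_injective 𝒪 ℤ K).isDomain
  have := IsIntegralClosure.isDedekindDomain ℤ ℚ K 𝒪
  have := IsIntegralClosure.isFractionRing_of_finite_extension ℤ ℚ K 𝒪
  have := IsIntegralClosure.finite ℤ ℚ K 𝒪
  have := CharZero.of_module (R := 𝒪) K
  let : MulSemiringAction Gal(K/ℚ) 𝒪 := IsIntegralClosure.MulSemiringAction ℤ ℚ K 𝒪
  have := IsGaloisGroup.of_isFractionRing Gal(K/ℚ) ℤ 𝒪 ℚ K
  have hP' : P.LiesOver (Ideal.span {p}) :=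
    (Ideal.liesOver_span_iff Ideal.IsPrime.ne_top' hp).mpr hP
  have hQ' : Q.LiesOver (Ideal.span {p}) :=
    (Ideal.liesOver_span_iff Ideal.IsPrime.ne_top' hp).mpr hQ
  exact Ideal.inertiaDeg_eq_of_isGaloisGroup (Ideal.span {p}) P Q Gal(K/ℚ)

/-- In a number field `K` Galois over `ℚ`: if one prime `P` above `p` has degree one
(`e(P|ℤ) · f(P|ℤ) = 1`), then every prime `Q` above `p` has degree one. -/
theorem degree_one_of_isGalois [IsGalois ℚ K] {p : ℤ} (hp : Prime p)
    (P : Ideal 𝒪) [P.IsPrime] (hP : (p : 𝒪) ∈ P)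
    (hef : P.ramificationIdx ℤ * P.inertiaDeg ℤ = 1)
    (Q : Ideal 𝒪) [Q.IsPrime] (hQ : (p : 𝒪) ∈ Q) :
    Q.ramificationIdx ℤ * Q.inertiaDeg ℤ = 1 := by
  rw [← T5UnramifiedOfGalois.ramificationIdx_eq_of_isGalois (K := K) hp P Q hP hQ,
    ← inertiaDeg_eq_of_isGalois (K := K) hp P Q hP hQ]
  exact hef

/-- **«p splits completely».** In a number field `K` Galois over `ℚ`: if one prime `P` above
the rational prime `p` has degree one, then the number of primes of the ring of integers above
`p` equals `[K : ℚ]` (Mathlib's Galois form of the fundamental identity `r · e · f = n`). -/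
theorem ncard_primesOver_eq_finrank_of_degree_one [IsGalois ℚ K] {p : ℤ} (hp : Prime p)
    (P : Ideal 𝒪) [P.IsPrime] (hP : (p : 𝒪) ∈ P)
    (hef : P.ramificationIdx ℤ * P.inertiaDeg ℤ = 1) :
    (Ideal.primesOver (Ideal.span {p}) 𝒪).ncard = Module.finrank ℚ K := by
  have := (IsIntegralClosure.algebraMap_injective 𝒪 ℤ K).isDomain
  have := IsIntegralClosure.isDedekindDomain ℤ ℚ K 𝒪
  have := IsIntegralClosure.isFractionRing_of_finite_extension ℤ ℚ K 𝒪
  have := IsIntegralClosure.finite ℤ ℚ K 𝒪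
  have := CharZero.of_module (R := 𝒪) K
  let : MulSemiringAction Gal(K/ℚ) 𝒪 := IsIntegralClosure.MulSemiringAction ℤ ℚ K 𝒪
  have := IsGaloisGroup.of_isFractionRing Gal(K/ℚ) ℤ 𝒪 ℚ K
  have hp' : (Ideal.span {p}).IsPrime := (Ideal.span_singleton_prime hp.ne_zero).mpr hp
  have hP' : P.LiesOver (Ideal.span {p}) :=
    (Ideal.liesOver_span_iff Ideal.IsPrime.ne_top' hp).mpr hP
  have h := Ideal.ncard_primesOver_mul_ramificationIdxIn_mul_inertiaDegIn
    (Ideal.span {p}) 𝒪 Gal(K/ℚ)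
  rw [Ideal.ramificationIdxIn_eq_ramificationIdx (Ideal.span {p}) P Gal(K/ℚ),
    Ideal.inertiaDegIn_eq_inertiaDeg (Ideal.span {p}) P Gal(K/ℚ), hef, mul_one,
    IsGaloisGroup.card_eq_finrank Gal(K/ℚ) ℚ K] at h
  exact h

end absolute

section relative

variable (F E : Type*) [Field F] [NumberField F] [Field E] [NumberField E] [Algebra F E]

/-- Tower form. Let `ℚ ⊂ F ⊂ E` with `E/ℚ` Galois, `𝔭` a prime of `𝓞 F` and `𝔓` a prime of
`𝓞 E` above `𝔭` of degree one over `ℚ` (`e(𝔓|ℤ) · f(𝔓|ℤ) = 1`). Then `𝔭` has exactly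
`[E : F]` primes of `𝓞 E` above it (`𝔭` splits completely in `E`). -/
theorem ncard_primesOver_eq_finrank_of_degree_one_tower [IsGalois ℚ E]
    (𝔭 : Ideal (𝓞 F)) [𝔭.IsPrime]
    (𝔓 : Ideal (𝓞 E)) [𝔓.IsPrime] [𝔓.LiesOver 𝔭]
    (hef : 𝔓.ramificationIdx ℤ * 𝔓.inertiaDeg ℤ = 1) :
    (𝔭.primesOver (𝓞 E)).ncard = Module.finrank F E := by
  have : IsGalois F E := IsGalois.tower_top_of_isGalois ℚ F E
  let : MulSemiringAction Gal(E/F) (𝓞 E) := IsIntegralClosure.MulSemiringAction (𝓞 F) F E (𝓞 E)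
  have := IsGaloisGroup.of_isFractionRing Gal(E/F) (𝓞 F) (𝓞 E) F E
  -- e and f of 𝔓 over 𝓞 F divide those over ℤ, hence are 1
  have he : 𝔓.ramificationIdx (𝓞 F) = 1 := by
    have h1 : 𝔓.ramificationIdx ℤ = 1 := Nat.eq_one_of_mul_eq_one_right hef
    have := Ideal.ramificationIdx_tower (R := ℤ) 𝔭 𝔓
    rw [h1] at this
    exact (Nat.eq_one_of_mul_eq_one_left this.symm)
  have hf : 𝔓.inertiaDeg (𝓞 F) = 1 := by
    have h1 : 𝔓.inertiaDeg ℤ = 1 := Nat.eq_one_of_mul_eq_one_left hef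
    have := Ideal.inertiaDeg_tower (R := ℤ) 𝔭 𝔓
    rw [h1] at this
    exact (Nat.eq_one_of_mul_eq_one_left this.symm)
  have h := Ideal.ncard_primesOver_mul_ramificationIdxIn_mul_inertiaDegIn 𝔭 (𝓞 E) Gal(E/F)
  rw [Ideal.ramificationIdxIn_eq_ramificationIdx 𝔭 𝔓 Gal(E/F),
    Ideal.inertiaDegIn_eq_inertiaDeg 𝔭 𝔓 Gal(E/F), he, hf, mul_one, mul_one,
    IsGaloisGroup.card_eq_finrank Gal(E/F) F E] at h
  exact h

/-- **(ord) for the datum.** Let `ℚ ⊂ F ⊂ E` with `E/ℚ` Galois and `p` a rational prime. If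
ONE prime `𝔓₀` of `𝓞 E` above `p` has degree one, then EVERY prime `𝔭` of `𝓞 F` above `p`
has exactly `[E : F]` primes of `𝓞 E` above it — Hsieh's «(ord) Every prime of F above p
splits in K» (arXiv:1112.1574 v3, Main_Body.tex l. 51; CHECK-G §12.2 row P1.3) for `(F, E)`. -/
theorem ord_of_isGalois_of_degree_one [IsGalois ℚ E] {p : ℤ} (hp : Prime p)
    (𝔓₀ : Ideal (𝓞 E)) [𝔓₀.IsPrime] (h𝔓₀ : (p : 𝓞 E) ∈ 𝔓₀)
    (hef : 𝔓₀.ramificationIdx ℤ * 𝔓₀.inertiaDeg ℤ = 1)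
    (𝔭 : Ideal (𝓞 F)) [𝔭.IsPrime] (h𝔭 : (p : 𝓞 F) ∈ 𝔭) :
    (𝔭.primesOver (𝓞 E)).ncard = Module.finrank F E := by
  -- a prime 𝔓 of 𝓞 E above 𝔭 exists (𝓞 E is integral over 𝓞 F)
  obtain ⟨⟨𝔓, h𝔓, h𝔓𝔭⟩⟩ := (inferInstance : Nonempty (𝔭.primesOver (𝓞 E)))
  -- 𝔓 contains p, hence has degree one over ℚ by the absolute statement
  have hp𝔓 : (p : 𝓞 E) ∈ 𝔓 := by
    have h1 := (Ideal.mem_of_liesOver (P := 𝔓) (p := 𝔭) (p : 𝓞 F)).mp h𝔭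
    rwa [map_intCast] at h1
  have hef' := degree_one_of_isGalois (K := E) hp 𝔓₀ h𝔓₀ hef 𝔓 hp𝔓
  exact ncard_primesOver_eq_finrank_of_degree_one_tower F E 𝔭 𝔓 hef'

end relative

end Summit.Ventures.HodgeRepro2.T5SplitsCompletely
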